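import Summits.AtomisticToContinuum.Crystallization.Theorems.ThreeConeCertificateSlackRigidityRootingFieldA
import HarnessLib

/-!
# Line `signed-root-silent-field` for crux `SlackRigidity` (stmt-AtomisticToContinuum-11960):
# rooting with the field channel, part B — the registered stub `stub_rootingField`

This is the landed c-layer rooting theorem `CLayerWitnessRooting.stub_rooting`
(`Theorems/ThreeConeCertificateSlackRigidityRooting.lean`) with the positive-type hypothesis on `f`
REPLACED by the smearing representation `f(|u − v|) = ∫ K(|y − u|) K(|y − v|) dy` (products
integrable, `K` continuous) and TWO more conclusions on the rooted bad sequence `S_k ∋ 0`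
(recentred thinned near-minimisers, `1/3`-separated, not root-matched at `(R, ε)`, vanishing local
`(F, U)`-slack): every `S_k` is finite, and the local `L²`-mass of the smeared field at the root
vanishes, `∫_{B(0,L)} (Σ_{q ∈ S_k} K(|y − q|))² dy → 0` for every `L` (the FIELD CHANNEL).

Proof.  For an injective configuration `z` put `Φ_z(w) = Σ_j K(|w − z_j|)`.  By part A
(`sum_star_add_interactionEnergy_add_field_le`) the three-channel TOTAL SLACK obeys
`Σ_i F(star_i) + Σ_{i<j} U + ½ ∫Φ_z² ≤ 𝓔_LJ(z) + (c + f(0)/2)·M` — the same right-hand side as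
the c-layer's `sum_star_add_interactionEnergy_le` — so steps (0)–(3) of `stub_rooting` (failing
witness `(R, ε, x, θ)`; thinning; the slack of the thinned `y_N` is `o(N)` by the trial bound;
`#bad(x_N) ≤ #bad(y_N) + o(N)` by `badCount_le_badCount_thinned`) go through verbatim with the
three-channel slack.  Step (4) is part A's `exists_bad_localSlack_field_le` (double counting in both
channels — packing count `card_filter_dist_le` at every point for the field — and Markov on the sum
of the two local weights): frequently some bad particle of `y_N` has `L`-local `(F,U)`-slack `≤ η`
AND `∫_{B(y_N i, L)} Φ² ≤ η`.  Step (5): diagonal `L = k`, `η = 1/(k+1)`, the dictionary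
`Good ↔ root-matched` (`good_iff_rootMatched_image`), and for the recentred set
`S_k = (· − z_i) '' range z` the field clause is the translate
`∫_{B(0,L)} (Σ_j K(|y − (z_j − z_i)|))² dy = ∫_{B(z_i,L)} Φ_z² ≤ ∫_{B(z_i,k)} Φ_z² ≤ 1/(k+1)`
(`tsum_image_sub_range`, `setIntegral_closedBall_zero_comp_add`, `setIntegral_mono_set`).
[folklore]
-/

noncomputable section

open scoped BigOperators Topology
open MeasureTheory Filter Set Metric
open Literature.MathematicalPhysics.StatisticalMechanics
open Summit.AtomisticToContinuum.Crystallization.Theorems.SlackRigidityNegative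
  (E3 Good badCount BadFractionVanishes ExcessVanishes RigidFor)
open Summit.AtomisticToContinuum.Crystallization.Theorems.CLayerWitnessRooting

namespace Summit.AtomisticToContinuum.Crystallization.Theorems.SignedRootRooting

/-! ## The registered stub -/

/-- **Stub 3a of line `signed-root-silent-field` — ROOTING WITH THE FIELD CHANNEL.** From the
thinning statement, certificate data for a periodic `P` (split `V_LJ = g + U + f` on `(0,∞)`,
`U ≥ 0`, smearing representation `f(|u−v|) = ∫ K(|y−u|) K(|y−v|) dy` with integrable products and
continuous `K`, star functional `F ≥ 0` with `Σ_i F(star_i) ≤ Σ_{i<j} g + cN`, exact constant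
`c + f(0)/2 = −e(P)`, trial-state bound) and a FAILURE of `RigidFor P`, a rooted small-slack bad
sequence of finite `1/3`-separated sets `S_k ∋ 0`, none root-matched at `(R, ε)`, with vanishing
local `(F, U)`-slack and vanishing local field mass `∫_{B(0,L)} (Σ_{q ∈ S_k} K(|y − q|))² dy`.
See the module docstring for the proof. [folklore] -/
theorem stub_rootingField :
  (∃ K : ℝ, 0 < K ∧ ∀ (N : ℕ) (x : Fin N → E3), Function.Injective x →
    ∃ (M : ℕ) (y : Fin M → E3), Function.Injective y ∧ Set.range y ⊆ Set.range x ∧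
      (∀ i j : Fin M, i ≠ j → (1 / 3 : ℝ) ≤ dist (y i) (y j)) ∧ M ≤ N ∧
      K * ((N : ℝ) - M) ≤ interactionEnergy lennardJones x - groundStateEnergy lennardJones 3 N ∧
      interactionEnergy lennardJones y ≤ interactionEnergy lennardJones x) →
  ∀ (P : PeriodicConfiguration 3) (c ρ' : ℝ) (g U f K : ℝ → ℝ) (F : Set E3 → ℝ),
    (∀ r : ℝ, 0 < r → lennardJones r = g r + U r + f r) →
    (∀ r : ℝ, 0 < r → 0 ≤ U r) →
    (∀ u v : E3, Integrable (fun y : E3 => K ‖y - u‖ * K ‖y - v‖)) →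
    (∀ u v : E3, f (dist u v) = ∫ y : E3, K ‖y - u‖ * K ‖y - v‖) →
    Continuous K →
    (∀ T : Set E3, 0 ≤ F T) →
    (∀ (N : ℕ) (x : Fin N → E3), Function.Injective x →
      ∑ i, F (((fun z => z - x i) '' Set.range x) ∩ Metric.closedBall 0 ρ') ≤
        interactionEnergy g x + c * N) →
    c + f 0 / 2 = -(P.energyPerParticle lennardJones) →
    (∀ η : ℝ, 0 < η → ∃ N₀ : ℕ, ∀ N : ℕ, N₀ ≤ N →
      groundStateEnergy lennardJones 3 N ≤ (N : ℝ) * (P.energyPerParticle lennardJones + η)) →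
    ¬ RigidFor P →
    ∃ (R ε : ℝ), 0 < R ∧ 0 < ε ∧ ∃ S : ℕ → Set E3,
      (∀ k, (S k).Finite) ∧
      (∀ k, ∀ p ∈ S k, ∀ q ∈ S k, p ≠ q → (1 / 3 : ℝ) ≤ dist p q) ∧
      (∀ k, (0 : E3) ∈ S k) ∧
      (∀ k, ¬ ∃ A : E3 →ₗᵢ[ℝ] E3,
        (∀ p ∈ P.points, ‖p‖ ≤ R → ∃ q ∈ S k, dist q (A p) ≤ ε) ∧
        (∀ q ∈ S k, ‖q‖ ≤ R → ∃ p ∈ P.points, dist q (A p) ≤ ε)) ∧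
      (∀ L η : ℝ, 0 < η → ∀ᶠ k in Filter.atTop, ∀ s ∈ S k, ‖s‖ ≤ L →
        F (((fun z => z - s) '' S k) ∩ Metric.closedBall 0 ρ') ≤ η ∧
        ∀ s' ∈ S k, s' ≠ s → ‖s'‖ ≤ L → U (dist s s') ≤ η) ∧
      (∀ L η : ℝ, 0 < η → ∀ᶠ k in Filter.atTop,
        ∫ y in Metric.closedBall (0 : E3) L, (∑' q : ↥(S k), K ‖y - (q : E3)‖) ^ 2 ≤ η) := by
  intro hthin P c ρ' g U f K F hsplit hU0 hint hfK _hKc hF0 hstar hid htrial hrig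
  classical
  -- (0) unpack the failing witness: `(R, ε)`, the bad sequence `x`, and `θ > 0`
  have hrig' : ∃ R ε : ℝ, 0 < R ∧ 0 < ε ∧ ∃ x : (N : ℕ) → Fin N → E3,
      (∀ N, Function.Injective (x N)) ∧ ExcessVanishes x ∧ ¬ BadFractionVanishes P R ε x := by
    by_contra hcon
    apply hrig
    intro R ε hR hε x hxinj hexc
    by_contra hbad
    exact hcon ⟨R, ε, hR, hε, x, hxinj, hexc, hbad⟩
  obtain ⟨R, ε, hR, hε, x, hxinj, hexc, hnot⟩ := hrig'
  obtain ⟨θ, hθ, hfreq⟩ := exists_frequently_le_of_not_tendsto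
    (u := fun N => (badCount P R ε (x N) : ℝ) / N) (fun N => by positivity) hnot
  -- (1) thinning
  obtain ⟨K₁, hK₁, hth⟩ := hthin
  choose M y hyinj hysub hysep hMN hKM hEy using fun N => hth N (x N) (hxinj N)
  -- abbreviations: the THREE-channel slack of the thinned configuration
  set e : ℝ := P.energyPerParticle lennardJones with he
  set slack : ℕ → ℝ := fun N =>
    ∑ i, F (((fun w => w - y N i) '' Set.range (y N)) ∩ Metric.closedBall 0 ρ') +
      interactionEnergy U (y N) + 1 / 2 * ∫ w : E3, (∑ j, K ‖w - y N j‖) ^ 2 with hslack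
  set excess : ℕ → ℝ := fun N =>
    interactionEnergy lennardJones (x N) - groundStateEnergy lennardJones 3 N with hexcess
  -- (2) the slack of the thinned configuration is `o(N)`
  have hsl : ∀ N, slack N ≤ excess N * (1 + |e| / K₁) +
      (groundStateEnergy lennardJones 3 N - N * e) := by
    intro N
    have ha : slack N ≤ interactionEnergy lennardJones (y N) + (c + f 0 / 2) * (M N) :=
      sum_star_add_interactionEnergy_add_field_le hsplit hint hfK hstar (hyinj N)
    have hb : ((N : ℝ) - M N) ≤ excess N / K₁ := by
      rw [le_div_iff₀ hK₁, mul_comm]; exact hKM N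
    have hc : e * ((N : ℝ) - M N) ≤ |e| * (excess N / K₁) := by
      have hNM : (0 : ℝ) ≤ (N : ℝ) - M N := by
        have h1 : ((M N : ℕ) : ℝ) ≤ N := by exact_mod_cast hMN N
        linarith
      exact (mul_le_mul_of_nonneg_right (le_abs_self e) hNM).trans
        (mul_le_mul_of_nonneg_left hb (abs_nonneg e))
    have hd := hEy N
    have hx' : interactionEnergy lennardJones (x N) =
        excess N + groundStateEnergy lennardJones 3 N := by
      simp only [hexcess]; ring
    have hexp : excess N * (1 + |e| / K₁) = excess N + |e| * (excess N / K₁) := by ring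
    rw [hid] at ha
    rw [hexp]
    linarith
  have h2c : ∀ κ : ℝ, 0 < κ → ∀ᶠ N in atTop, slack N ≤ κ * N := by
    intro κ hκ
    have hA : 0 < 1 + |e| / K₁ := by positivity
    set κ' : ℝ := κ / (2 * (1 + |e| / K₁)) with hκ'
    have hκ'pos : 0 < κ' := by positivity
    obtain ⟨N₀, hN₀⟩ := htrial (κ / 2) (by positivity)
    have hev : ∀ᶠ N : ℕ in atTop, excess N / N < κ' := (tendsto_order.1 hexc).2 κ' hκ'pos
    filter_upwards [hev, eventually_ge_atTop N₀, eventually_ge_atTop 1] with N hN hN₀N hN1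
    have hNpos : (0 : ℝ) < N := by exact_mod_cast hN1
    have h1 : excess N < κ' * N := by rwa [div_lt_iff₀ hNpos] at hN
    have h2 : groundStateEnergy lennardJones 3 N - N * e ≤ N * (κ / 2) := by
      have := hN₀ N hN₀N; linarith
    have h3 : excess N * (1 + |e| / K₁) ≤ κ' * N * (1 + |e| / K₁) :=
      mul_le_mul_of_nonneg_right h1.le hA.le
    have h4 : κ' * N * (1 + |e| / K₁) = κ / 2 * N := by
      rw [hκ']; field_simp
    linarith [hsl N]
  -- (3) frequently many bad particles survive the thinning
  have h3c : ∃ᶠ N in atTop, θ / 2 * N < Nat.card {i : Fin (M N) // ¬ Good P R ε (y N) i} ∧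
      (1 : ℝ) ≤ N := by
    have hev1 : ∀ᶠ N : ℕ in atTop, excess N / K₁ * (1 + (6 * R + 1) ^ 3) < θ / 2 * N := by
      have hpos : 0 < θ / 2 / ((1 + (6 * R + 1) ^ 3) / K₁) := by positivity
      have hev := (tendsto_order.1 hexc).2 _ hpos
      filter_upwards [hev, eventually_ge_atTop 1] with N hN hN1
      have hNpos : (0 : ℝ) < N := by exact_mod_cast hN1
      have hX : 0 < (1 + (6 * R + 1) ^ 3) / K₁ := by positivity
      rw [div_lt_iff₀ hNpos] at hN
      have h' := mul_lt_mul_of_pos_right hN hX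
      have hrw : θ / 2 / ((1 + (6 * R + 1) ^ 3) / K₁) * N * ((1 + (6 * R + 1) ^ 3) / K₁) =
          θ / 2 * N := by
        field_simp
      calc excess N / K₁ * (1 + (6 * R + 1) ^ 3)
          = excess N * ((1 + (6 * R + 1) ^ 3) / K₁) := by ring
        _ < θ / 2 * N := by rw [← hrw]; exact h'
    refine (hfreq.and_eventually (hev1.and (eventually_ge_atTop 1))).mono ?_
    rintro N ⟨hθN, hev, hN1⟩
    have hN1' : (1 : ℝ) ≤ N := by exact_mod_cast hN1
    have hNpos : (0 : ℝ) < N := by linarith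
    refine ⟨?_, hN1'⟩
    have hbx : θ * N ≤ (badCount P R ε (x N) : ℝ) := by rwa [le_div_iff₀ hNpos] at hθN
    have htr := badCount_le_badCount_thinned P R ε (hxinj N) (hysep N) (hysub N) hR.le
    have hb : ((N : ℝ) - M N) * (1 + (6 * R + 1) ^ 3) ≤
        excess N / K₁ * (1 + (6 * R + 1) ^ 3) := by
      refine mul_le_mul_of_nonneg_right ?_ (by positivity)
      rw [le_div_iff₀ hK₁, mul_comm]; exact hKM N
    have : (badCount P R ε (x N) : ℝ) = Nat.card {i : Fin N // ¬ Good P R ε (x N) i} := rfl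
    rw [this] at hbx
    linarith
  -- (4) frequently a bad particle of small local slack in BOTH channels
  have h4c : ∀ L η : ℝ, 0 ≤ L → 0 < η → ∃ᶠ N in atTop, ∃ i : Fin (M N),
      ¬ Good P R ε (y N) i ∧
      ∑ j' ∈ Finset.univ.filter (fun j' => dist (y N j') (y N i) ≤ L),
        (F (((fun w => w - y N j') '' Set.range (y N)) ∩ Metric.closedBall 0 ρ') +
          siteEnergy U (y N) j') ≤ η ∧
      ∫ w in Metric.closedBall (y N i) L, (∑ j, K ‖w - y N j‖) ^ 2 ≤ η := by
    intro L η hL hη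
    have hC : 0 < (6 * L + 1) ^ 3 := by positivity
    have hκ : 0 < θ * η / (16 * (6 * L + 1) ^ 3) := by positivity
    refine (h3c.and_eventually (h2c _ hκ)).mono ?_
    rintro N ⟨⟨hbad, hN1⟩, hsN⟩
    refine exists_bad_localSlack_field_le P R ε hU0 hF0 hint (hysep N) hL hη
      (lt_of_le_of_lt ?_ hbad)
    rw [div_le_iff₀ hη]
    have h1 : (6 * L + 1) ^ 3 * (2 * slack N) ≤
        (6 * L + 1) ^ 3 * (2 * (θ * η / (16 * (6 * L + 1) ^ 3) * N)) :=
      mul_le_mul_of_nonneg_left (by linarith) hC.le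
    have h2 : (6 * L + 1) ^ 3 * (2 * (θ * η / (16 * (6 * L + 1) ^ 3) * N)) = θ * η * N / 8 := by
      field_simp; ring
    have h3 : θ * η * N / 8 ≤ θ / 2 * N * η := by
      have hprod : 0 < θ * η * N := by positivity
      have hrw : θ / 2 * N * η = 4 * (θ * η * N / 8) := by ring
      rw [hrw]; linarith
    have h5 : (6 * L + 1) ^ 3 * (2 * (∑ j, F (((fun w => w - y N j) '' Set.range (y N)) ∩
        Metric.closedBall 0 ρ') + interactionEnergy U (y N)) +
        ∫ w : E3, (∑ j, K ‖w - y N j‖) ^ 2) = (6 * L + 1) ^ 3 * (2 * slack N) := by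
      simp only [hslack]; ring
    rw [h5]
    exact h1.trans (h2.le.trans h3)
  -- (5) the diagonal choice
  have h5 : ∀ k : ℕ, ∃ N : ℕ, ∃ i : Fin (M N), ¬ Good P R ε (y N) i ∧
      ∑ j' ∈ Finset.univ.filter (fun j' => dist (y N j') (y N i) ≤ (k : ℝ)),
        (F (((fun w => w - y N j') '' Set.range (y N)) ∩ Metric.closedBall 0 ρ') +
          siteEnergy U (y N) j') ≤ 1 / ((k : ℝ) + 1) ∧
      ∫ w in Metric.closedBall (y N i) k, (∑ j, K ‖w - y N j‖) ^ 2 ≤ 1 / ((k : ℝ) + 1) :=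
    fun k => (h4c k (1 / ((k : ℝ) + 1)) (Nat.cast_nonneg k) (by positivity)).exists
  choose Nk ik hbadk hσk hφk using h5
  refine ⟨R, ε, hR, hε, fun k => (fun w => w - y (Nk k) (ik k)) '' Set.range (y (Nk k)),
    fun k => (Set.finite_range _).image _,
    fun k => separated_image_sub_range (hysep (Nk k)) _,
    fun k => ⟨y (Nk k) (ik k), ⟨ik k, rfl⟩, sub_self _⟩,
    fun k hmatch => hbadk k ((good_iff_rootMatched_image P R ε (y (Nk k)) (ik k)).2 hmatch),
    fun L η hη => ?_, fun L η hη => ?_⟩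
  · -- local `(F, U)`-slack control along the diagonal
    refine Filter.eventually_atTop.2 ⟨max ⌈L⌉₊ ⌈1 / η⌉₊, fun k hk => ?_⟩
    obtain ⟨hkL, hkη⟩ := le_and_one_div_le_of_max_ceil_le (L := L) hη hk
    set z := y (Nk k) with hz
    set i := ik k with hi
    have hzinj : Function.Injective z := hyinj (Nk k)
    intro s hs hsL
    obtain ⟨_, ⟨j, rfl⟩, rfl⟩ := hs
    have hji : dist (z j) (z i) ≤ (k : ℝ) := by
      rw [dist_eq_norm]; exact hsL.trans hkL
    obtain ⟨hF, hU⟩ := star_le_localSlack_and_pair_le (ρ' := ρ') hU0 hF0 hzinj hji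
    have hσ := hσk k
    refine ⟨?_, ?_⟩
    · rw [image_sub_image_sub]
      exact hF.trans (hσ.trans hkη)
    · intro s' hs' hne _
      obtain ⟨_, ⟨j', rfl⟩, rfl⟩ := hs'
      have hjj' : j' ≠ j := fun h => hne (by rw [h])
      rw [dist_sub_sub_eq]
      exact (hU j' hjj').trans (hσ.trans hkη)
  · -- the field channel along the diagonal
    refine Filter.eventually_atTop.2 ⟨max ⌈L⌉₊ ⌈1 / η⌉₊, fun k hk => ?_⟩
    obtain ⟨hkL, hkη⟩ := le_and_one_div_le_of_max_ceil_le (L := L) hη hk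
    show ∫ yv in Metric.closedBall (0 : E3) L,
      (∑' q : ↥((fun w => w - y (Nk k) (ik k)) '' Set.range (y (Nk k))),
        K ‖yv - (q : E3)‖) ^ 2 ≤ η
    set z := y (Nk k) with hz
    set i := ik k with hi
    have hzinj : Function.Injective z := hyinj (Nk k)
    have htsum : ∀ w : E3, ∑' q : ↥((fun w => w - z i) '' Set.range z), K ‖w - (q : E3)‖ =
        ∑ j, K ‖w + z i - z j‖ := by
      intro w
      rw [tsum_image_sub_range hzinj i (fun q => K ‖w - q‖)]
      refine Finset.sum_congr rfl fun j _ => ?_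
      rw [sub_sub_eq_add_sub]
    simp only [htsum]
    calc ∫ yv in Metric.closedBall (0 : E3) L, (∑ j, K ‖yv + z i - z j‖) ^ 2
        = ∫ w in Metric.closedBall (z i) L, (∑ j, K ‖w - z j‖) ^ 2 :=
          setIntegral_closedBall_zero_comp_add (fun w => (∑ j, K ‖w - z j‖) ^ 2) (z i) L
      _ ≤ ∫ w in Metric.closedBall (z i) k, (∑ j, K ‖w - z j‖) ^ 2 :=
          setIntegral_mono_set (integrable_field_sq hint z).integrableOn
            (Eventually.of_forall fun w => sq_nonneg _)
            (Metric.closedBall_subset_closedBall hkL).eventuallyLE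
      _ ≤ 1 / ((k : ℝ) + 1) := hφk k
      _ ≤ η := hkη

end Summit.AtomisticToContinuum.Crystallization.Theorems.SignedRootRooting

end
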